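import Mathlib
import Summits.AnomalousDissipation.AnomalousDissipation.Theorems.SolenoidalFractalHomogenisationLagrangianStepW7SlotStep
import HarnessLib

/-!
# K1L_D (stmt-AnomalousDissipation-27980), W7 ENGINE S1b — THE ABSTRACT SLOT STEP WITH POINTWISE DATA ON THE SLOT ONLY
# (helper; `--supports stmt-AnomalousDissipation-27980 --as helper`)

`W7Slot.slot_step` (p673119) asks transversality `kdot K_j (w_j t) = 0` and the drain floor `q‖w₀ t‖² ≤ ‖P_{K₊}w₀ t‖² + ‖P_{K₋}w₀ t‖²`
for ALL real `t`, while the weak-solution mode calculus S1a (prover ad-k1l-cellLawV-w1 g4: `CellChain.kdot_modeRep`) delivers the continuous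
representatives transversal on `[0,T]` only.  **`slot_step_on`** is `slot_step` with those two hypotheses restricted to the slot `t ∈ [t₀, t₁]`
(everything else byte-identical): apply `slot_step` to the modes CLAMPED to the slot, `t ↦ w_j (max t₀ (min t t₁))` — same values on the
slot, same a.e. chain ODE in its interior (`HasDerivAt.congr_of_eventuallyEq`; the two endpoints are null), absolute continuity transported
by `AbsolutelyContinuousOnInterval.congr_uIcc` (agreement on `uIcc` suffices — proved here from `absolutelyContinuousOnInterval_iff`).
No definitions, no sorry.  W7 assembly owner: prover ad-sawtooth-k1loc-p1 g11.  NOT a proof of the crux / of AD; rung F-D1.A0.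
[cite: BedrossianCotiZelati2017, §2 (hypocoercivity functional with a cross term, Grönwall)] [problem: turb]
-/

set_option linter.dupNamespace false

/-- Absolute continuity on `uIcc a b` only depends on the values on `uIcc a b`. -/
theorem AbsolutelyContinuousOnInterval.congr_uIcc {X : Type*} [PseudoMetricSpace X] {f g : ℝ → X} {a b : ℝ}
    (hf : AbsolutelyContinuousOnInterval f a b) (h : Set.EqOn f g (Set.uIcc a b)) :
    AbsolutelyContinuousOnInterval g a b := by
  rw [absolutelyContinuousOnInterval_iff] at hf ⊢
  intro ε hε
  obtain ⟨δ, hδ, H⟩ := hf ε hε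
  refine ⟨δ, hδ, fun E hE hs => ?_⟩
  have hE' := hE
  simp only [AbsolutelyContinuousOnInterval.disjWithin, Set.mem_setOf_eq] at hE'
  calc ∑ i ∈ Finset.range E.1, dist (g (E.2 i).1) (g (E.2 i).2)
      = ∑ i ∈ Finset.range E.1, dist (f (E.2 i).1) (f (E.2 i).2) :=
        Finset.sum_congr rfl fun i hi => by rw [h (hE'.1 i hi).1, h (hE'.1 i hi).2]
    _ < ε := H E hE hs

namespace Summit.AnomalousDissipation.AnomalousDissipation.Theorems.SolenoidalFractalHomogenisation.LagrangianStep.W7Slot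

open Set Real MeasureTheory intervalIntegral Filter Topology
open scoped InnerProductSpace
open Literature.Analysis.FluidPDE Literature.Analysis.FluidPDE.Torus
open Literature.Analysis.FunctionSpaces.Torus (freqNormSq)
open Summit.AnomalousDissipation.AnomalousDissipation.Theorems.SolenoidalFractalHomogenisation.LagrangianStep.ThreeMode
open Summit.AnomalousDissipation.AnomalousDissipation.Theorems.SolenoidalFractalHomogenisation.LagrangianStep.W7Engine

/-- **THE ABSTRACT SLOT STEP, pointwise data on the slot only**: `W7Slot.slot_step` with transversality `hT0…hTmm` and the drain floor `hqw`
asked for `t ∈ Icc t₀ t₁` only (proof: clamp the modes to the slot and call `slot_step`).  Same conclusion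
`E t₁ ≤ exp(−∫_{t₀}^{t₁} min(σ/(9/8), σ/(7/8)))·E t₀`. [cite: BedrossianCotiZelati2017, §2 (hypocoercivity functional)] -/
theorem slot_step_on {𝔹 : Visc4 (Fin 3)} {lo hi β : ℝ} (h𝔹 : NearIso 𝔹 lo hi) (hlo : 0 ≤ lo) (hhi : 0 ≤ hi)
    (hodd : OddSmall 𝔹 β) (hβ : 0 ≤ β)
    {K0 Kp Km Kpp Kmm : Fin 3 → ℤ} (hKp : Kp ≠ 0) (hKm : Km ≠ 0)
    {t₀ t₁ : ℝ} (hT : t₀ < t₁)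
    {w0 wp wm wpp wmm : ℝ → (EuclideanSpace ℂ (Fin 3))} {E Q A Ad : ℝ → ℝ} {μ c ε q dmin dtwo Dmax : ℝ}
    (hμ : 0 < μ) (hc : 0 ≤ c) (hε : 0 ≤ ε) (hdmin : 0 < dmin) (hdtwo : 0 ≤ dtwo)
    (hdp : dmin ≤ 4 * Real.pi ^ 2 * lo * freqNormSq Kp) (hdm : dmin ≤ 4 * Real.pi ^ 2 * lo * freqNormSq Km)
    (hdpp : dtwo ≤ 4 * Real.pi ^ 2 * lo * freqNormSq Kpp) (hdmm : dtwo ≤ 4 * Real.pi ^ 2 * lo * freqNormSq Kmm)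
    (hDp : 4 * Real.pi ^ 2 * (hi + β / 2) * freqNormSq Kp ≤ Dmax) (hDm : 4 * Real.pi ^ 2 * (hi + β / 2) * freqNormSq Km ≤ Dmax)
    (hdD : dmin ≤ Dmax)
    (c1 : 8 * ε * c ^ 2 ≤ dmin) (c2 : 4 * ε * Dmax ^ 2 ≤ dmin) (c3 : ε * c ^ 2 ≤ dtwo)
    (c4 : 32 * ε ^ 2 * c ^ 2 * (4 * Real.pi ^ 2 * (hi + β / 2) * freqNormSq K0) ^ 2
      ≤ (4 * Real.pi ^ 2 * lo * freqNormSq K0) * dmin)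
    (hAc : Continuous A) (hA01 : ∀ t ∈ Icc t₀ t₁, 0 ≤ A t ∧ A t ≤ 1) (hA0 : A t₀ = 0) (hA1 : A t₁ = 0)
    (hAac : AbsolutelyContinuousOnInterval A t₀ t₁) (hAd : ∀ᵐ t, t ∈ uIcc t₀ t₁ → HasDerivAt A (Ad t) t)
    (hAd2 : ∀ᵐ t, t ∈ uIcc t₀ t₁ → Ad t ^ 2 ≤ 4 / (t₁ - t₀) ^ 2)
    (hT0 : ∀ t ∈ Icc t₀ t₁, kdot K0 (w0 t) = 0) (hTp : ∀ t ∈ Icc t₀ t₁, kdot Kp (wp t) = 0)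
    (hTm : ∀ t ∈ Icc t₀ t₁, kdot Km (wm t) = 0)
    (hTpp : ∀ t ∈ Icc t₀ t₁, kdot Kpp (wpp t) = 0) (hTmm : ∀ t ∈ Icc t₀ t₁, kdot Kmm (wmm t) = 0)
    (hqw : ∀ t ∈ Icc t₀ t₁, q * ‖w0 t‖ ^ 2 ≤ ‖transversalProj Kp (w0 t)‖ ^ 2 + ‖transversalProj Km (w0 t)‖ ^ 2)
    (h0ac : AbsolutelyContinuousOnInterval w0 t₀ t₁) (hpac : AbsolutelyContinuousOnInterval wp t₀ t₁)
    (hmac : AbsolutelyContinuousOnInterval wm t₀ t₁)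
    (hd0 : ∀ᵐ t, t ∈ uIcc t₀ t₁ → HasDerivAt w0 (dW0C (c * A t) K0 (wp t) (wm t) (modalAdjGen 𝔹 K0 (w0 t))) t)
    (hdp' : ∀ᵐ t, t ∈ uIcc t₀ t₁ → HasDerivAt wp (dWpC (c * A t) Kp (w0 t) (wpp t) (modalAdjGen 𝔹 Kp (wp t))) t)
    (hdm' : ∀ᵐ t, t ∈ uIcc t₀ t₁ → HasDerivAt wm (dWmC (c * A t) Km (w0 t) (wmm t) (modalAdjGen 𝔹 Km (wm t))) t)
    (hEac : AbsolutelyContinuousOnInterval E t₀ t₁) (hEd : ∀ᵐ t, t ∈ uIcc t₀ t₁ → HasDerivAt E (-2 * Q t) t)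
    (hE5 : ∀ t ∈ Icc t₀ t₁, μ * (‖w0 t‖ ^ 2 + ‖wp t‖ ^ 2 + ‖wm t‖ ^ 2 + ‖wpp t‖ ^ 2 + ‖wmm t‖ ^ 2) ≤ E t)
    (hQ : ∀ᵐ t, t ∈ uIcc t₀ t₁ →
      μ * ((⟪modalAdjGen 𝔹 K0 (w0 t), w0 t⟫_ℂ).re + (⟪modalAdjGen 𝔹 Kp (wp t), wp t⟫_ℂ).re
          + (⟪modalAdjGen 𝔹 Km (wm t), wm t⟫_ℂ).re + (⟪modalAdjGen 𝔹 Kpp (wpp t), wpp t⟫_ℂ).re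
          + (⟪modalAdjGen 𝔹 Kmm (wmm t), wmm t⟫_ℂ).re)
        + (dmin / 2) * (E t - μ * (‖w0 t‖ ^ 2 + ‖wp t‖ ^ 2 + ‖wm t‖ ^ 2 + ‖wpp t‖ ^ 2 + ‖wmm t‖ ^ 2)) ≤ Q t) :
    E t₁ ≤ Real.exp (-∫ s in t₀..t₁,
        min ((min (ε * c ^ 2 * (q * A s ^ 2 / 2 - 8 * ε / (dmin * (t₁ - t₀) ^ 2))) (min dmin dtwo)) / (9 / 8))
            ((min (ε * c ^ 2 * (q * A s ^ 2 / 2 - 8 * ε / (dmin * (t₁ - t₀) ^ 2))) (min dmin dtwo)) / (7 / 8))) * E t₀ := by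
  have ht : t₀ ≤ t₁ := hT.le
  have hIcc : uIcc t₀ t₁ = Icc t₀ t₁ := uIcc_of_le ht
  -- the clamp to the slot
  set cl : ℝ → ℝ := fun t => max t₀ (min t t₁) with hcl
  have hcl_mem : ∀ t, cl t ∈ Icc t₀ t₁ := fun t => ⟨le_max_left _ _, max_le ht (min_le_right _ _)⟩
  have hcl_id : ∀ t ∈ Icc t₀ t₁, cl t = t := fun t htI => by
    simp only [hcl, min_eq_left htI.2, max_eq_right htI.1]
  have hcl_ev : ∀ t ∈ Ioo t₀ t₁, ∀ᶠ s in 𝓝 t, cl s = s := fun t htI => by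
    filter_upwards [Ioo_mem_nhds htI.1 htI.2] with s hs using hcl_id s (Ioo_subset_Icc_self hs)
  have hends : ∀ᵐ t : ℝ, t ∉ ({t₀, t₁} : Set ℝ) :=
    compl_mem_ae_iff.2 (Set.Finite.measure_zero (by simp) _)
  have hinner : ∀ t, t ∉ ({t₀, t₁} : Set ℝ) → t ∈ uIcc t₀ t₁ → t ∈ Ioo t₀ t₁ := by
    intro t hne htI
    simp only [mem_insert_iff, mem_singleton_iff, not_or] at hne
    rw [hIcc] at htI
    exact ⟨lt_of_le_of_ne htI.1 (Ne.symm hne.1), lt_of_le_of_ne htI.2 hne.2⟩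
  -- agreement on the slot transports absolute continuity
  have hEq : ∀ (w : ℝ → EuclideanSpace ℂ (Fin 3)), EqOn w (fun t => w (cl t)) (uIcc t₀ t₁) := by
    intro w t htI
    rw [hIcc] at htI
    show w t = w (cl t)
    rw [hcl_id t htI]
  -- the a.e. chain ODE of the clamped modes
  have hd0' : ∀ᵐ t, t ∈ uIcc t₀ t₁ → HasDerivAt (fun x => w0 (cl x))
      (dW0C (c * A t) K0 (wp (cl t)) (wm (cl t)) (modalAdjGen 𝔹 K0 (w0 (cl t)))) t := by
    filter_upwards [hd0, hends] with t hd hne htI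
    have hto := hinner t hne htI
    rw [hcl_id t (Ioo_subset_Icc_self hto)]
    refine (hd htI).congr_of_eventuallyEq ?_
    filter_upwards [hcl_ev t hto] with s hs
    rw [hs]
  have hdp'' : ∀ᵐ t, t ∈ uIcc t₀ t₁ → HasDerivAt (fun x => wp (cl x))
      (dWpC (c * A t) Kp (w0 (cl t)) (wpp (cl t)) (modalAdjGen 𝔹 Kp (wp (cl t)))) t := by
    filter_upwards [hdp', hends] with t hd hne htI
    have hto := hinner t hne htI
    rw [hcl_id t (Ioo_subset_Icc_self hto)]
    refine (hd htI).congr_of_eventuallyEq ?_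
    filter_upwards [hcl_ev t hto] with s hs
    rw [hs]
  have hdm'' : ∀ᵐ t, t ∈ uIcc t₀ t₁ → HasDerivAt (fun x => wm (cl x))
      (dWmC (c * A t) Km (w0 (cl t)) (wmm (cl t)) (modalAdjGen 𝔹 Km (wm (cl t)))) t := by
    filter_upwards [hdm', hends] with t hd hne htI
    have hto := hinner t hne htI
    rw [hcl_id t (Ioo_subset_Icc_self hto)]
    refine (hd htI).congr_of_eventuallyEq ?_
    filter_upwards [hcl_ev t hto] with s hs
    rw [hs]
  have hE5' : ∀ t ∈ Icc t₀ t₁, μ * (‖w0 (cl t)‖ ^ 2 + ‖wp (cl t)‖ ^ 2 + ‖wm (cl t)‖ ^ 2 + ‖wpp (cl t)‖ ^ 2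
      + ‖wmm (cl t)‖ ^ 2) ≤ E t := fun t htI => by
    rw [hcl_id t htI]; exact hE5 t htI
  have hQ' : ∀ᵐ t, t ∈ uIcc t₀ t₁ →
      μ * ((⟪modalAdjGen 𝔹 K0 (w0 (cl t)), w0 (cl t)⟫_ℂ).re + (⟪modalAdjGen 𝔹 Kp (wp (cl t)), wp (cl t)⟫_ℂ).re
          + (⟪modalAdjGen 𝔹 Km (wm (cl t)), wm (cl t)⟫_ℂ).re + (⟪modalAdjGen 𝔹 Kpp (wpp (cl t)), wpp (cl t)⟫_ℂ).re
          + (⟪modalAdjGen 𝔹 Kmm (wmm (cl t)), wmm (cl t)⟫_ℂ).re)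
        + (dmin / 2) * (E t - μ * (‖w0 (cl t)‖ ^ 2 + ‖wp (cl t)‖ ^ 2 + ‖wm (cl t)‖ ^ 2 + ‖wpp (cl t)‖ ^ 2
          + ‖wmm (cl t)‖ ^ 2)) ≤ Q t := by
    filter_upwards [hQ] with t hq htI
    have e := hcl_id t (by rwa [hIcc] at htI)
    rw [e]
    exact hq htI
  exact slot_step h𝔹 hlo hhi hodd hβ hKp hKm hT (w0 := fun t => w0 (cl t)) (wp := fun t => wp (cl t))
    (wm := fun t => wm (cl t)) (wpp := fun t => wpp (cl t)) (wmm := fun t => wmm (cl t))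
    hμ hc hε hdmin hdtwo hdp hdm hdpp hdmm hDp hDm hdD c1 c2 c3 c4 hAc hA01 hA0 hA1 hAac hAd hAd2
    (fun t => hT0 _ (hcl_mem t)) (fun t => hTp _ (hcl_mem t)) (fun t => hTm _ (hcl_mem t))
    (fun t => hTpp _ (hcl_mem t)) (fun t => hTmm _ (hcl_mem t)) (fun t => hqw _ (hcl_mem t))
    (h0ac.congr_uIcc (hEq w0)) (hpac.congr_uIcc (hEq wp)) (hmac.congr_uIcc (hEq wm))
    hd0' hdp'' hdm'' hEac hEd hE5' hQ'

end Summit.AnomalousDissipation.AnomalousDissipation.Theorems.SolenoidalFractalHomogenisation.LagrangianStep.W7Slot
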